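import Summits.QuantumFields.YangMills.Theorems.TwistExponentGapLatticeCocycle
import Literature.MathematicalPhysics.QuantumFieldTheory.YangMillsOS
import HarnessLib

/-!
# Gauge invariance of the twisted Wilson action (central twist)
# (route-independent helper toward the crux `TwistExponentGap.RigidTwistCeiling` ⟨stmt-QuantumFields-24054⟩, step (W3); free hands
# of width seat ym-line-sfw-p2-w3)

The crux's inline `z`-twisted Wilson action `Σ_p (N − Re tr r(z_p · U_p))` (`z_p ∈ {z, 1}`, `z` central) is invariant under lattice
gauge transformations `U ↦ g·U` (`gaugeTransform`): the plaquette holonomy is conjugated by `g(x)`, the central twist commutes,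
and the trace is conjugation invariant (`twistedAction_gaugeTransform`; the class-function identity is the tree's `AnchorGap.GaugeAvg.trace_rep_conj`, inlined).  Consumed by `localMorseBott_of_gaugeMinimal`
(`TwistExponentGapGaugeReduction`).
HONEST FRAMING: bookkeeping; nothing here bears on a summit statement or on the Yang–Mills mass gap.
-/

set_option autoImplicit false

noncomputable section

open scoped Matrix BigOperators
open Literature.MathematicalPhysics.QuantumFieldTheory

namespace Summit.QuantumFields.YangMills.Theorems.TwistExponentGap

variable {G : Type*} [Group G]

/-- Plaquette holonomies transform by conjugation at the base point. -/
theorem plaquetteHolonomy_gaugeTransform {d S : ℕ} (g : Site d S → G) (U : GaugeConfig d S G) (x : Site d S) (μ ν : Fin d) :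
    plaquetteHolonomy (gaugeTransform g U) x μ ν = g x * plaquetteHolonomy U x μ ν * (g x)⁻¹ := by
  simp only [plaquetteHolonomy, gaugeTransform, site_shift_shift_comm x μ ν]
  group

/-- **Gauge invariance of the twisted action** (central twist on the stack `p.2 = q ∧ p.1 q.1.1 = 0 ∧ p.1 q.1.2 = 0`). -/
theorem twistedAction_gaugeTransform {N d S : ℕ} [NeZero S] (ρ : G →* Matrix (Fin N) (Fin N) ℂ)
    (q : {p : Fin d × Fin d // p.1 < p.2})
    {z : G} (hz : z ∈ Subgroup.center G) (g : Site d S → G) (U : GaugeConfig d S G) :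
    ∑ p : Plaquette d S, ((N : ℝ) - (ρ ((if p.2 = q ∧ p.1 q.1.1 = 0 ∧ p.1 q.1.2 = 0 then z else 1) *
        plaquetteHolonomy (gaugeTransform g U) p.1 p.2.1.1 p.2.1.2)).trace.re) =
      ∑ p : Plaquette d S, ((N : ℝ) - (ρ ((if p.2 = q ∧ p.1 q.1.1 = 0 ∧ p.1 q.1.2 = 0 then z else 1) *
        plaquetteHolonomy U p.1 p.2.1.1 p.2.1.2)).trace.re) := by
  refine Finset.sum_congr rfl fun p _ => ?_
  set t : G := (if p.2 = q ∧ p.1 q.1.1 = 0 ∧ p.1 q.1.2 = 0 then z else 1) with ht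
  have htc : t ∈ Subgroup.center G := by rw [ht]; split_ifs; exacts [hz, one_mem _]
  have hcomm : ∀ a : G, a * t = t * a := fun a => Subgroup.mem_center_iff.1 htc a
  rw [plaquetteHolonomy_gaugeTransform]
  have h : t * (g p.1 * plaquetteHolonomy U p.1 p.2.1.1 p.2.1.2 * (g p.1)⁻¹) =
      g p.1 * (t * plaquetteHolonomy U p.1 p.2.1.1 p.2.1.2) * (g p.1)⁻¹ := by
    calc t * (g p.1 * plaquetteHolonomy U p.1 p.2.1.1 p.2.1.2 * (g p.1)⁻¹)
        = (t * g p.1) * plaquetteHolonomy U p.1 p.2.1.1 p.2.1.2 * (g p.1)⁻¹ := by group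
      _ = (g p.1 * t) * plaquetteHolonomy U p.1 p.2.1.1 p.2.1.2 * (g p.1)⁻¹ := by rw [hcomm]
      _ = g p.1 * (t * plaquetteHolonomy U p.1 p.2.1.1 p.2.1.2) * (g p.1)⁻¹ := by group
  -- the trace is conjugation invariant (tree: `AnchorGap.GaugeAvg.trace_rep_conj`, re-derived inline to keep the cone thin)
  rw [h, map_mul, map_mul, Matrix.trace_mul_cycle, ← map_mul, inv_mul_cancel, map_one, one_mul]

end Summit.QuantumFields.YangMills.Theorems.TwistExponentGap

end
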